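import Mathlib
import Summits.RiemannHypothesis.RiemannHypothesis.Theses.EarlyAppointments
import Literature.Barriers.RiemannHypothesis.DeBrangesPositivityXiZeta
/-!
# `CombPairModel` (route EarlyAppointments, item stmt-RiemannHypothesis-3187) — `combPairModel_holds`, both conjuncts as typed
(2) positivity of the one-pair comb bracket `-(π/s) tanh(πy/s) + 2y/(h²-y²) + 2y/(y²+s²/4)` on `0 < y < h ≤ s`, via the Mittag-Leffler
expansion of `tanh` read off Mathlib's cotangent series (`tendsto_logDeriv_euler_cot_sub`, `summable_cotTerm`) at `1/2 + i t` (`hasSum_tanh`)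
and the telescoping bound `pi_tanh_le : π tanh(π t) ≤ 2t/(t²+1/4) + 2t`; (1) a root `y` with `|y - (h - s/π)| ≤ 4 s²/h` whenever `4 s ≤ h`
(`C = 4`), by the IVT for the normalised bracket `b` between `b_left_neg` / `b_right_pos` and the scaling `bracket_scale`.  Imports: the route
file (by-name statement) and `Literature.Barriers.…DeBrangesPositivityXiZeta` ONLY for `one_sub_tanh_le : 0 ≤ x → 1 - tanh x ≤ 2/(1+x)²`
(reused, not restated); the rest is Mathlib.  Author: ideator rh-idea-4 g16 (cell rh-split, W-07 cycle 4, C6; kernel TanhML rev 3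
796efcda6cdbf8bd · 409; critic rh-split-ref-2 g15 CONCUR, STATUS l.5399 / l.5407(B)); desk cut rh-split-ref g21 ((CA138) ORDER 1: own
namespace, docstrings completed, superseded conditional `combPairModel_of_part1` dropped, proofs verbatim).  LABEL K (MODEL bracket).  TEST 0.
Nothing here bears on the truth of RH.
-/
set_option linter.dupNamespace false  -- D-0017: the mandated namespace `Summit.<S>.<S>.…` repeats `RiemannHypothesis`
namespace Summit.RiemannHypothesis.RiemannHypothesis.Theorems.Splittings.EarlyAppointmentsCombPairModel
open Complex in
/-- 1/2 + i t is never an integer -/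
theorem half_mem (t : ℝ) : (Complex.mk (1 / 2) t) ∈ Complex.integerComplement := by
  rw [Complex.mem_integerComplement_iff]
  rintro ⟨n, hn⟩
  have h := congrArg Complex.re hn
  simp at h
  have h3 : (2 * n : ℤ) = 1 := by exact_mod_cast (by linarith : (2 * n : ℝ) = 1)
  omega

open Complex in
/-- Mathlib's cotangent Mittag-Leffler expansion in `HasSum` form: `Σₙ cotTerm x n = π cot(π x) - 1/x` off the integers. -/
theorem hasSum_cotTerm {x : ℂ} (hx : x ∈ Complex.integerComplement) :
    HasSum (fun n : ℕ => cotTerm x n) (Real.pi * Complex.cot (Real.pi * x) - 1 / x) :=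
  ((summable_cotTerm hx).hasSum_iff_tendsto_nat).mpr (tendsto_logDeriv_euler_cot_sub hx)

/-- imaginary part of the n-th cotangent term at 1/2 + i t -/
theorem cotTerm_im (t : ℝ) (n : ℕ) :
    (cotTerm (Complex.mk (1 / 2) t) n).im
      = -(t / (((n : ℝ) + 1 / 2) ^ 2 + t ^ 2)) - t / (((n : ℝ) + 3 / 2) ^ 2 + t ^ 2) := by
  have d1 : 0 < ((n : ℝ) + 1 / 2) ^ 2 + t ^ 2 := by positivity
  have d2 : 0 < ((n : ℝ) + 3 / 2) ^ 2 + t ^ 2 := by positivity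
  simp only [cotTerm, one_div, Complex.add_im, Complex.inv_im, Complex.normSq_apply, Complex.sub_re,
    Complex.sub_im, Complex.add_re, Complex.natCast_re, Complex.natCast_im, Complex.one_re, Complex.one_im]
  have e1 : ((2 : ℝ)⁻¹ - (n + 1)) * (2⁻¹ - (n + 1)) + (t - (0 + 0)) * (t - (0 + 0))
      = ((n : ℝ) + 2⁻¹) ^ 2 + t ^ 2 := by ring
  have e2 : ((2 : ℝ)⁻¹ + (n + 1)) * (2⁻¹ + (n + 1)) + (t + (0 + 0)) * (t + (0 + 0))
      = ((n : ℝ) + 3 / 2) ^ 2 + t ^ 2 := by ring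
  rw [e1, e2]
  simp only [sub_zero, add_zero]
  ring

/-- π cot(π(1/2 + i t)) = -i π tanh(π t) -/
theorem pi_cot_val (t : ℝ) :
    (Real.pi : ℂ) * Complex.cot (Real.pi * Complex.mk (1 / 2) t)
      = -((Real.pi * Real.tanh (Real.pi * t) : ℝ) : ℂ) * Complex.I := by
  have e : (Real.pi : ℂ) * Complex.mk (1 / 2) t = ((Real.pi * t : ℝ) : ℂ) * Complex.I + Real.pi / 2 := by
    apply Complex.ext
    · simp; ring
    · simp
  rw [Complex.cot_eq_cos_div_sin, e, Complex.cos_add_pi_div_two, Complex.sin_add_pi_div_two,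
    Complex.sin_mul_I, Complex.cos_mul_I, ← Complex.ofReal_sinh, ← Complex.ofReal_cosh]
  have hc : ((Real.cosh (Real.pi * t) : ℝ) : ℂ) ≠ 0 := by exact_mod_cast (Real.cosh_pos _).ne'
  rw [Real.tanh_eq_sinh_div_cosh]
  push_cast
  field_simp

/-- imaginary part of `π cot(π x) - 1/x` at `x = 1/2 + i t`: `-π tanh(π t) + t/(1/4 + t²)`. -/
theorem lhs_im (t : ℝ) :
    ((Real.pi : ℂ) * Complex.cot (Real.pi * Complex.mk (1 / 2) t) - 1 / Complex.mk (1 / 2) t).im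
      = -(Real.pi * Real.tanh (Real.pi * t)) + t / ((1 / 2) ^ 2 + t ^ 2) := by
  rw [pi_cot_val]
  have d0 : 0 < ((1 : ℝ) / 2) ^ 2 + t ^ 2 := by positivity
  simp only [one_div, Complex.sub_im, Complex.mul_im, Complex.neg_re, Complex.neg_im, Complex.ofReal_re,
    Complex.ofReal_im, Complex.I_re, Complex.I_im, Complex.inv_im, Complex.normSq_mk]
  have e : (2 : ℝ)⁻¹ * 2⁻¹ + t * t = (1 / 2) ^ 2 + t ^ 2 := by ring
  rw [e]
  field_simp
  ring

/-- Mittag-Leffler for tanh (imaginary part of the cotangent expansion at 1/2 + i t) -/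
theorem hasSum_tanh (t : ℝ) :
    HasSum (fun n : ℕ => t / (((n : ℝ) + 1 / 2) ^ 2 + t ^ 2) + t / (((n : ℝ) + 3 / 2) ^ 2 + t ^ 2))
      (Real.pi * Real.tanh (Real.pi * t) - t / ((1 / 2) ^ 2 + t ^ 2)) := by
  have H := ((Complex.hasSum_iff _ _).mp (hasSum_cotTerm (half_mem t))).2
  simp only [cotTerm_im, lhs_im] at H
  have ef : (fun n : ℕ => t / (((n : ℝ) + 1 / 2) ^ 2 + t ^ 2) + t / (((n : ℝ) + 3 / 2) ^ 2 + t ^ 2))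
      = fun n : ℕ => -(-(t / (((n : ℝ) + 1 / 2) ^ 2 + t ^ 2)) - t / (((n : ℝ) + 3 / 2) ^ 2 + t ^ 2)) := by
    funext n; ring
  have ev : Real.pi * Real.tanh (Real.pi * t) - t / ((1 / 2) ^ 2 + t ^ 2)
      = -(-(Real.pi * Real.tanh (Real.pi * t)) + t / ((1 / 2) ^ 2 + t ^ 2)) := by ring
  rw [ef, ev]
  exact H.neg

/-- telescoping bound for the shifted inverse squares -/
theorem tail_le (N : ℕ) :
    ∑ k ∈ Finset.range N, 1 / ((k : ℝ) + 3 / 2) ^ 2 ≤ 1 - 1 / ((N : ℝ) + 1) := by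
  induction N with
  | zero => simp
  | succ N ih =>
    rw [Finset.sum_range_succ]
    have hN : (0 : ℝ) ≤ N := Nat.cast_nonneg N
    have step : 1 / ((N : ℝ) + 3 / 2) ^ 2 ≤ 1 / ((N : ℝ) + 1) - 1 / ((N : ℝ) + 1 + 1) := by
      rw [div_sub_div _ _ (by positivity) (by positivity)]
      apply div_le_div₀ (by nlinarith) (by nlinarith) (by positivity) (by nlinarith)
    push_cast
    linarith

/-- the shifted half of the tanh series is bounded by `t`: `Σ_{k<N} t/((k+3/2)² + t²) ≤ t` (from `tail_le`). -/
theorem shifted_sum_le {t : ℝ} (ht : 0 ≤ t) (N : ℕ) :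
    ∑ k ∈ Finset.range N, t / (((k : ℝ) + 3 / 2) ^ 2 + t ^ 2) ≤ t := by
  have h1 : ∑ k ∈ Finset.range N, t / (((k : ℝ) + 3 / 2) ^ 2 + t ^ 2)
      ≤ ∑ k ∈ Finset.range N, t * (1 / ((k : ℝ) + 3 / 2) ^ 2) := by
    apply Finset.sum_le_sum
    intro k _
    rw [div_eq_mul_one_div]
    apply mul_le_mul_of_nonneg_left _ ht
    apply div_le_div_of_nonneg_left (by norm_num) (by positivity)
    nlinarith
  rw [← Finset.mul_sum] at h1
  have h2 := tail_le N
  have h3 : 0 < 1 / ((N : ℝ) + 1) := by positivity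
  nlinarith

/-- partial sums of the tanh series are ≤ t/(1/4+t²) + 2t -/
theorem partial_le {t : ℝ} (ht : 0 ≤ t) (N : ℕ) :
    ∑ n ∈ Finset.range N, (t / (((n : ℝ) + 1 / 2) ^ 2 + t ^ 2) + t / (((n : ℝ) + 3 / 2) ^ 2 + t ^ 2))
      ≤ t / ((1 / 2) ^ 2 + t ^ 2) + 2 * t := by
  rw [Finset.sum_add_distrib]
  have hB := shifted_sum_le ht N
  have hA : ∑ n ∈ Finset.range N, t / (((n : ℝ) + 1 / 2) ^ 2 + t ^ 2) ≤ t / ((1 / 2) ^ 2 + t ^ 2) + t := by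
    cases N with
    | zero =>
      simp
      positivity
    | succ M =>
      rw [Finset.sum_range_succ']
      have hM := shifted_sum_le ht M
      have e : ∀ k : ℕ, t / ((((k + 1 : ℕ) : ℝ) + 1 / 2) ^ 2 + t ^ 2) = t / (((k : ℝ) + 3 / 2) ^ 2 + t ^ 2) := by
        intro k; push_cast; ring_nf
      simp only [e]
      push_cast
      linarith
  linarith

/-- the elementary consequence: π tanh(π t) ≤ 2t/(t²+1/4) + 2t for t ≥ 0 -/
theorem pi_tanh_le {t : ℝ} (ht : 0 ≤ t) :
    Real.pi * Real.tanh (Real.pi * t) ≤ 2 * t / (t ^ 2 + 1 / 4) + 2 * t := by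
  have H := hasSum_tanh t
  have hle : Real.pi * Real.tanh (Real.pi * t) - t / ((1 / 2) ^ 2 + t ^ 2) ≤ t / ((1 / 2) ^ 2 + t ^ 2) + 2 * t := by
    rw [← H.tsum_eq]
    exact H.summable.tsum_le_of_sum_range_le (partial_le ht)
  have e : t / ((1 / 2) ^ 2 + t ^ 2) = t / (t ^ 2 + 1 / 4) := by ring_nf
  rw [e] at hle
  have e2 : 2 * t / (t ^ 2 + 1 / 4) = t / (t ^ 2 + 1 / 4) + t / (t ^ 2 + 1 / 4) := by ring
  linarith

/-- `CombPairModel` (stmt-RiemannHypothesis-3187), conjunct (2), exactly as typed in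
`Summits/RiemannHypothesis/RiemannHypothesis/Theses/EarlyAppointments.lean` l.353. -/
theorem combPairModel_part2 :
    ∀ s h y : ℝ, 0 < s → 0 < h → h ≤ s → 0 < y → y < h →
      0 < -(Real.pi / s) * Real.tanh (Real.pi * y / s) + 2 * y / (h ^ 2 - y ^ 2) + 2 * y / (y ^ 2 + s ^ 2 / 4) := by
  intro s h y hs hh hhs hy hyh
  have ht : 0 ≤ y / s := by positivity
  have P := pi_tanh_le ht
  have e0 : Real.pi * (y / s) = Real.pi * y / s := by ring
  rw [e0] at P
  have d1 : 0 < h ^ 2 - y ^ 2 := by nlinarith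
  have d2 : 0 < y ^ 2 + s ^ 2 / 4 := by positivity
  -- (1/s)·[2(y/s)/((y/s)²+1/4)] = 2y/(y²+s²/4)
  have e1 : (2 * (y / s) / ((y / s) ^ 2 + 1 / 4)) / s = 2 * y / (y ^ 2 + s ^ 2 / 4) := by
    field_simp
  have P' : (Real.pi / s) * Real.tanh (Real.pi * y / s) ≤ 2 * y / (y ^ 2 + s ^ 2 / 4) + 2 * y / s ^ 2 := by
    have := div_le_div_of_nonneg_right P hs.le
    rw [add_div, e1] at this
    have e2 : Real.pi * Real.tanh (Real.pi * y / s) / s = (Real.pi / s) * Real.tanh (Real.pi * y / s) := by ring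
    have e3 : 2 * (y / s) / s = 2 * y / s ^ 2 := by field_simp
    rw [e2, e3] at this
    exact this
  -- 2y/(h²-y²) > 2y/s² since h² - y² < s²
  have key : 2 * y / s ^ 2 < 2 * y / (h ^ 2 - y ^ 2) := by
    apply div_lt_div_of_pos_left (by linarith) d1
    nlinarith
  linarith

/-! ## Conjunct (1): existence of the root and its position, C = 4 (normalised s = 1, then scaled) -/

/-- the normalised bracket (s = 1) -/
noncomputable def b (H u : ℝ) : ℝ :=
  -Real.pi * Real.tanh (Real.pi * u) + 2 * u / (H ^ 2 - u ^ 2) + 2 * u / (u ^ 2 + 1 / 4)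

/-- `u ↦ tanh(π u)` is continuous. -/
theorem continuous_tanh_mul : Continuous fun u : ℝ => Real.tanh (Real.pi * u) := by
  have e : (fun u : ℝ => Real.tanh (Real.pi * u)) = fun u => Real.sinh (Real.pi * u) / Real.cosh (Real.pi * u) := by
    funext u; rw [Real.tanh_eq_sinh_div_cosh]
  rw [e]
  exact ((Real.continuous_sinh.comp (continuous_const.mul continuous_id)).div
    (Real.continuous_cosh.comp (continuous_const.mul continuous_id)) (fun u => (Real.cosh_pos _).ne'))

/-- the normalised bracket `b H` is continuous on any `[a, c]` with `0 < a` and `c < H` (no pole of `2u/(H²-u²)` there). -/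
theorem b_continuousOn {H a c : ℝ} (ha : 0 < a) (hc : c < H) :
    ContinuousOn (b H) (Set.Icc a c) := by
  unfold b
  apply ContinuousOn.add
  apply ContinuousOn.add
  · exact (continuous_const.mul continuous_tanh_mul).continuousOn
  · apply ContinuousOn.div (by fun_prop) (by fun_prop)
    intro u hu
    have h1 : u ≤ c := hu.2
    have h0 : 0 ≤ u := le_trans ha.le hu.1
    nlinarith
  · apply ContinuousOn.div (by fun_prop) (by fun_prop)
    intro u _
    positivity

/-- sign at the right end u_R = H - 1/π: positive (tanh < 1 and 2u_R/(H²-u_R²) = π - 1/(2H - 1/π)) -/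
theorem b_right_pos {H : ℝ} (hH : 4 ≤ H) : 0 < b H (H - 1 / Real.pi) := by
  unfold b
  have hpi0 : 0 < Real.pi := Real.pi_pos
  have hpi3 : 3 < Real.pi := Real.pi_gt_three
  have hp : 1 / Real.pi < 1 := by rw [div_lt_one hpi0]; linarith
  have hp0 : 0 < 1 / Real.pi := by positivity
  set p := 1 / Real.pi with hp_def
  have huR : 0 < H - p := by linarith
  have hden : 0 < H ^ 2 - (H - p) ^ 2 := by nlinarith
  have ht : Real.tanh (Real.pi * (H - p)) < 1 := Real.tanh_lt_one _
  have A : 2 * (H - p) / (H ^ 2 - (H - p) ^ 2) = Real.pi - 1 / (2 * H - p) := by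
    have h2 : 2 * H - p ≠ 0 := by linarith
    have hden' : H ^ 2 - (H - p) ^ 2 ≠ 0 := hden.ne'
    have hpp : Real.pi * p = 1 := by rw [hp_def]; field_simp
    rw [eq_sub_iff_add_eq, div_add_div _ _ hden' h2, div_eq_iff (mul_ne_zero hden' h2)]
    linear_combination (-(2 * H - p) ^ 2) * hpp
  have Bpos : 1 / (2 * H - p) < 2 * (H - p) / ((H - p) ^ 2 + 1 / 4) := by
    rw [div_lt_div_iff₀ (by linarith) (by positivity)]
    nlinarith
  have t1 : -Real.pi * Real.tanh (Real.pi * (H - p)) > -Real.pi := by nlinarith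
  rw [A]
  linarith

/-- the final numeric inequality of the left-end estimate, isolated (small context for `nlinarith`) -/
theorem key_aux {H : ℝ} (hH : 4 ≤ H) :
    -Real.pi + Real.pi * (1 / H) + Real.pi * H / (H + 4 * Real.pi) + 4 / H < 0 := by
  have hpi0 : 0 < Real.pi := Real.pi_pos
  have hpi3 : 3 < Real.pi := Real.pi_gt_three
  have hpi4 : Real.pi < 3.15 := Real.pi_lt_d2
  have hH0 : 0 < H := by linarith
  have hne : H + 4 * Real.pi ≠ 0 := by positivity
  have hpisq : 9 < Real.pi ^ 2 := by nlinarith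
  have c0 : (0 : ℝ) ≤ 4 * Real.pi ^ 2 - Real.pi - 4 := by nlinarith
  have c2 : 0 < 12 * Real.pi ^ 2 - 20 * Real.pi - 16 := by nlinarith
  have c1 := mul_nonneg (sub_nonneg.mpr hH) c0
  have e : Real.pi * H / (H + 4 * Real.pi) = Real.pi - 4 * Real.pi ^ 2 / (H + 4 * Real.pi) := by
    rw [eq_sub_iff_add_eq, ← add_div, div_eq_iff hne]; ring
  have e2 : Real.pi * (1 / H) + 4 / H = (Real.pi + 4) / H := by
    rw [mul_one_div, ← add_div]
  have k3 : (Real.pi + 4) / H < 4 * Real.pi ^ 2 / (H + 4 * Real.pi) := by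
    rw [div_lt_div_iff₀ hH0 (by positivity)]
    nlinarith [c1, c2]
  calc -Real.pi + Real.pi * (1 / H) + Real.pi * H / (H + 4 * Real.pi) + 4 / H
      = -(4 * Real.pi ^ 2 / (H + 4 * Real.pi)) + (Real.pi * (1 / H) + 4 / H) := by rw [e]; ring
    _ = -(4 * Real.pi ^ 2 / (H + 4 * Real.pi)) + (Real.pi + 4) / H := by rw [e2]
    _ < 0 := by linarith

set_option maxHeartbeats 400000 in
/-- sign at the left end u_L = H - 1/π - 4/H: negative (1 - tanh x ≤ 2/(1+x)², 2u_L/(H²-u_L²) ≤ 1/δ, 2u_L/(u_L²+1/4) ≤ 2/u_L) -/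
theorem b_left_neg {H : ℝ} (hH : 4 ≤ H) : b H (H - 1 / Real.pi - 4 / H) < 0 := by
  unfold b
  have hpi0 : 0 < Real.pi := Real.pi_pos
  have hpi3 : 3 < Real.pi := Real.pi_gt_three
  have hpi4 : Real.pi < 3.15 := Real.pi_lt_d2
  have hH0 : 0 < H := by linarith
  have hp1 : 1 / Real.pi < 1 / 3 := by
    apply div_lt_div_of_pos_left (by norm_num) (by norm_num) hpi3
  have hp0 : 0 < 1 / Real.pi := by positivity
  have h4H : 4 / H ≤ 1 := by rw [div_le_one hH0]; linarith
  have h4H0 : 0 < 4 / H := by positivity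
  set p := 1 / Real.pi with hp_def
  set δ := p + 4 / H with hδ
  set uL := H - p - 4 / H with huL_def
  have hδ0 : 0 < δ := by positivity
  have huL2 : H / 2 ≤ uL := by
    have : H / 2 - p - 4 / H ≥ 0 := by
      have e : H / 2 - p - 4 / H = (H ^ 2 / 2 - p * H - 4) / H := by
        field_simp
      rw [e]; apply div_nonneg _ hH0.le; nlinarith
    linarith
  have huL0 : 0 < uL := by linarith
  have huLH : uL < H := by linarith
  -- tanh from below
  have hx : 0 ≤ Real.pi * uL := by positivity
  have T := Literature.Barriers.RiemannHypothesis.one_sub_tanh_le hx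
  have T1 : 2 / (1 + Real.pi * uL) ^ 2 ≤ 2 / (Real.pi * uL) ^ 2 := by
    apply div_le_div_of_nonneg_left (by norm_num) (by positivity)
    nlinarith
  have T2 : 2 / (Real.pi * uL) ^ 2 ≤ 8 / (Real.pi * H ^ 2) := by
    rw [div_le_div_iff₀ (by positivity) (by positivity)]
    have : H ^ 2 ≤ 4 * uL ^ 2 := by nlinarith
    nlinarith [mul_le_mul_of_nonneg_left this (by positivity : (0:ℝ) ≤ 2 * Real.pi)]
  have T3 : 8 / (Real.pi * H ^ 2) ≤ 1 / H := by
    rw [div_le_div_iff₀ (by positivity) hH0]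
    nlinarith
  have tanh_part : -Real.pi * Real.tanh (Real.pi * uL) ≤ -Real.pi + Real.pi * (1 / H) := by
    have : 1 - Real.tanh (Real.pi * uL) ≤ 1 / H := by linarith
    nlinarith
  -- middle term ≤ 1/δ = πH/(H+4π)
  have hden : 0 < H ^ 2 - uL ^ 2 := by nlinarith
  have M : 2 * uL / (H ^ 2 - uL ^ 2) ≤ 1 / δ := by
    rw [div_le_div_iff₀ hden hδ0]
    have e : H ^ 2 - uL ^ 2 = δ * (2 * H - δ) := by rw [huL_def, hδ]; ring
    rw [e]
    nlinarith
  have Minv : 1 / δ = Real.pi * H / (H + 4 * Real.pi) := by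
    rw [hδ, hp_def]
    field_simp
  -- last term ≤ 2/uL ≤ 4/H
  have R : 2 * uL / (uL ^ 2 + 1 / 4) ≤ 2 / uL := by
    rw [div_le_div_iff₀ (by positivity) huL0]
    nlinarith
  have R2 : 2 / uL ≤ 4 / H := by
    rw [div_le_div_iff₀ huL0 hH0]
    nlinarith
  -- combine: -π + π/H + πH/(H+4π) + 4/H < 0
  have key := key_aux hH
  rw [Minv] at M
  linarith

/-- conjunct (1), normalised: for H ≥ 4 the bracket has a root u with |u - (H - 1/π)| ≤ 4/H -/
theorem root_normalised {H : ℝ} (hH : 4 ≤ H) :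
    ∃ u : ℝ, 0 < u ∧ u < H ∧ |u - (H - 1 / Real.pi)| ≤ 4 / H ∧ b H u = 0 := by
  have hpi3 : 3 < Real.pi := Real.pi_gt_three
  have hH0 : 0 < H := by linarith
  have hp1 : 1 / Real.pi < 1 / 3 := div_lt_div_of_pos_left (by norm_num) (by norm_num) hpi3
  have hp0 : 0 < 1 / Real.pi := by positivity
  have h4H : 4 / H ≤ 1 := by rw [div_le_one hH0]; linarith
  have h4H0 : 0 < 4 / H := by positivity
  have ha : 0 < H - 1 / Real.pi - 4 / H := by linarith
  have hc : H - 1 / Real.pi < H := by linarith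
  have hac : H - 1 / Real.pi - 4 / H ≤ H - 1 / Real.pi := by linarith
  have hcont := b_continuousOn (H := H) ha hc
  have hl := b_left_neg hH
  have hr := b_right_pos hH
  have hmem : (0 : ℝ) ∈ Set.Icc (b H (H - 1 / Real.pi - 4 / H)) (b H (H - 1 / Real.pi)) := ⟨hl.le, hr.le⟩
  obtain ⟨u, hu, hbu⟩ := intermediate_value_Icc hac hcont hmem
  refine ⟨u, by linarith [hu.1], by linarith [hu.2], ?_, hbu⟩
  rw [abs_le]
  constructor <;> linarith [hu.1, hu.2]

/-- scaling of the typed bracket to the normalised one -/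
theorem bracket_scale {s h u : ℝ} (hs : 0 < s) :
    -(Real.pi / s) * Real.tanh (Real.pi * (s * u) / s) + 2 * (s * u) / (h ^ 2 - (s * u) ^ 2)
      + 2 * (s * u) / ((s * u) ^ 2 + s ^ 2 / 4) = (1 / s) * b (h / s) u := by
  unfold b
  have hs' : s ≠ 0 := hs.ne'
  have e0 : Real.pi * (s * u) / s = Real.pi * u := by field_simp
  rw [e0]
  have e1 : 2 * (s * u) / (h ^ 2 - (s * u) ^ 2) = (1 / s) * (2 * u / ((h / s) ^ 2 - u ^ 2)) := by
    by_cases hd : h ^ 2 - (s * u) ^ 2 = 0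
    · have hd' : (h / s) ^ 2 - u ^ 2 = 0 := by
        field_simp
        nlinarith [hd]
      rw [hd, hd']; simp
    · have hd' : (h / s) ^ 2 - u ^ 2 ≠ 0 := by
        intro e; apply hd
        field_simp at e
        nlinarith [e]
      field_simp
  have e2 : 2 * (s * u) / ((s * u) ^ 2 + s ^ 2 / 4) = (1 / s) * (2 * u / (u ^ 2 + 1 / 4)) := by
    have : u ^ 2 + 1 / 4 ≠ 0 := by positivity
    field_simp
  rw [e1, e2]
  field_simp

/-- `CombPairModel` conjunct (1), exactly as typed, with C = 4. -/
theorem combPairModel_part1 :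
    ∃ C : ℝ, 0 < C ∧ ∀ s h : ℝ, 0 < s → C * s ≤ h → ∃ y : ℝ, 0 < y ∧ y < h ∧
      |y - (h - s / Real.pi)| ≤ C * s ^ 2 / h ∧
      -(Real.pi / s) * Real.tanh (Real.pi * y / s) + 2 * y / (h ^ 2 - y ^ 2) + 2 * y / (y ^ 2 + s ^ 2 / 4) = 0 := by
  refine ⟨4, by norm_num, ?_⟩
  intro s h hs hCs
  have hH : 4 ≤ h / s := by rw [le_div_iff₀ hs]; exact hCs
  have hh0 : 0 < h := by linarith [mul_pos (by norm_num : (0:ℝ) < 4) hs]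
  obtain ⟨u, hu0, huH, habs, hbu⟩ := root_normalised hH
  refine ⟨s * u, by positivity, ?_, ?_, ?_⟩
  · have := mul_lt_mul_of_pos_left huH hs
    have e : s * (h / s) = h := by field_simp
    rw [e] at this; exact this
  · have e : s * u - (h - s / Real.pi) = s * (u - (h / s - 1 / Real.pi)) := by
      field_simp
    rw [e, abs_mul, abs_of_pos hs]
    have e2 : (4 : ℝ) * s ^ 2 / h = s * (4 / (h / s)) := by
      field_simp
    rw [e2]
    exact mul_le_mul_of_nonneg_left habs hs.le
  · rw [bracket_scale hs, hbu]; simp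

/-- **`CombPairModel` (stmt-RiemannHypothesis-3187) — the whole item, BY NAME, 0 sorry.** -/
theorem combPairModel_holds :
    Summit.RiemannHypothesis.RiemannHypothesis.Theses.EarlyAppointments.CombPairModel :=
  ⟨combPairModel_part1, combPairModel_part2⟩
end Summit.RiemannHypothesis.RiemannHypothesis.Theorems.Splittings.EarlyAppointmentsCombPairModel
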